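/-
Copyright: lit-balaban cell, Phase-2 proof seat p33 (gen 6).  Statement-level skeleton of a published paper; no proof claims beyond
what the kernel checks below.
-/
import Literature.MathematicalPhysics.QuantumFieldTheory.BalabanImbrieJaffe1984to88.BIJ85Ineq732BackgroundStab

/-!
# `BalabanImbrieJaffe1984to88.BIJ85Ineq732BackgroundRate` — T. Bałaban, J. Imbrie, A. Jaffe, *Renormalization of the Higgs model:
minimizers, propagators and the stability of mean field theory*, Commun. Math. Phys. **97** (1985) 299–329
[BalabanImbrieJaffe1985]: the PRINTED RATE of the mass term in (7.3.2) p. 326 — from a (7.2.2)-shaped sup bound on the smoothing phase of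
the background (4.5.4), `L^k·max_b|θ_b| ≤ K·e_k·𝓅(e_k)` with `𝓅(e_k) = (1 + ln e_k^{−1})^p` (the factor of (7.3.1)), to the printed
`Me_k^{2−α}` with `α = 1`: the calculus `e^α·𝓅(e)² ≤ (1 + 2p/α)^{2p}` (`0 < e ≤ 1`) and r15's `Claim73` for the family of (4.5.4)-shaped
backgrounds indexed by that printed-form rate (file 6 of this seat's member of SKELETON row **C1.Eq7.3.1-7.3.2**; file 5 =
`BIJ85Ineq732BackgroundStab` p265577 has the rate in the already-converted form `(L^kT)² ≤ K²e_k^{2−α₀}`).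

statement-level skeleton of published theorems with citation tags; proofs where landed; nothing here is a claim about the Yang–Mills mass gap

PDF held: `paper:balaban1985-cmp97-bij-higgs-minimizers` (journal page = PDF page + 298).  Pages read (`lit read`, OCR text): p. 326 [PDF 28].

CITATION HEADER (lean-in-tree rule).  Phase-2 file of the lit-balaban TYPED SKELETON (HOME `run/shared/lean/pub/lit-balaban/`), seat p33 gen 6
(unit `lit-balaban-p33-g6`; TAKING line HOME/STATUS.md 2026-08-21T10:38:53Z; owner r15, referee ref-5; GAPS G-C1-05).  Objects BY NAME: file 5's
`BgIdx`/`bgStabData`/`ineq732_bgStabData`, r15's `ScalarStabData.Claim73`.  Two definitions with bodies (the index `BgIdxP` and its map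
`BgIdxP.toBgIdx` into file 5's index), no instance beyond the structure, no named fact.

THE PRINTED TEXT, verbatim (p. 326 [PDF 28]): *"let us assume that for the unit lattice field v, |v(∂p) − 1| ≤ e_k𝓅(e_k), (7.3.1) where
𝓅(e_k) = (1 + ln e_k^{−1})^p. Then the stability estimate can be stated in two forms. For constants γ > 0, α > 0, M < ∞,
⟨φ, Δ_k(u_k)φ⟩ ≥ γ Σ_{b∈T₁^{(k)}} |u_k(b)φ(b₊) − φ(b₋)|² − Me_k^{2−α} Σ_{x∈T₁^{(k)}} |φ(x)|². (7.3.2)"*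

WHAT IS PROVED (0 `sorry`, standard axioms).
* `rpow_mul_calP_sq_le` — for `0 < e ≤ 1`, `0 < α`, `0 ≤ p`: `e^α·((1 + ln e^{−1})^p)² ≤ (1 + 2p/α)^{2p}` (`ln x ≤ x^ε/ε`, `ε = α/(2p)`);
  `sq_le_of_calP_rate` — `0 ≤ τ ≤ K·e·(1 + ln e^{−1})^p`, `0 < e ≤ 1` ⇒ `τ² ≤ K²(1+2p)^{2p}·e^{2−1}` (the case `α = 1`).
* **`claim73_backgroundP`** — r15's `ScalarStabData.Claim73 p fam` INHABITED for the family of (4.5.4)-shaped backgrounds `Q^{s*}_kv·e^{iθ}`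
  over `BgIdxP d K p` (any torus, `k ≥ 1`, `0 < e_k ≤ 1`, ANY `v`, any phase with `|θ_b| ≤ T`, the block-scale smallness
  `36d(2d+1)²(L^kT)² ≤ 1` and the PRINTED-FORM RATE `L^kT ≤ K·e_k·𝓅(e_k)`): `γ = min(a/(10d), ⅕)`, `α = 1`, `M = 32γd(2d+1)²K²(1+2p)^{2p}`
  (through file 5's `ineq732_bgStabData` at `K′ = K(1+2p)^p`, `α₀ = 1`); non-vacuity `hyp731_backgroundP_one`.
HONEST SCOPE.  In print `L^kT = e_k‖𝒟_k∂^*Q^{e*}_kf^{(k)}‖_∞` and the rate is (7.2.2) under (7.3.1) (row C1.Eq7.2.2, typed, not proved here);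
here it is the index's hypothesis on the phase.  Nothing printed is contradicted or weakened.
-/

open scoped RealInnerProductSpace BigOperators
open Finset

namespace Literature.MathematicalPhysics.QuantumFieldTheory.BalabanImbrieJaffe1984to88.BIJ85Ineq732BackgroundRate

open Literature.MathematicalPhysics.QuantumFieldTheory.Balaban1983to89
open BIJ88Sect3Statements (U1 toC cfg plaqVar toC_one)
open BIJ85Ineq732Flat (FlatIdx)
open BIJ85Ineq732BackgroundStab

noncomputable section

/-! ## §1 The calculus of the printed rate: `e^α·𝓅(e)² ≤ C(α, p)` -/

/-- kernel (calculus of the factor `𝓅(e_k) = (1 + ln e_k^{−1})^p` of (7.3.1)): for `0 < e ≤ 1`, `0 < α`, `0 ≤ p`,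
`e^α·((1 + ln e^{−1})^p)² ≤ (1 + 2p/α)^{2p}` — from `ln x ≤ x^ε/ε` at `x = e^{−1}`, `ε = α/(2p)`. [cite: BalabanImbrieJaffe1985, (7.3.1) p.326] -/
theorem rpow_mul_calP_sq_le {e α p : ℝ} (he : 0 < e) (he1 : e ≤ 1) (hα : 0 < α) (hp : 0 ≤ p) :
    e ^ α * ((1 + Real.log e⁻¹) ^ p) ^ 2 ≤ (1 + 2 * p / α) ^ (2 * p) := by
  have hinv1 : 1 ≤ e⁻¹ := (one_le_inv₀ he).2 he1
  have hlog0 : 0 ≤ Real.log e⁻¹ := Real.log_nonneg hinv1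
  have hb0 : 0 ≤ 1 + Real.log e⁻¹ := by linarith
  have heα : e ^ α ≤ 1 := Real.rpow_le_one he.le he1 hα.le
  have heα0 : 0 ≤ e ^ α := Real.rpow_nonneg he.le α
  have hsq : ((1 + Real.log e⁻¹) ^ p) ^ 2 = (1 + Real.log e⁻¹) ^ (2 * p) := by
    rw [← Real.rpow_natCast, ← Real.rpow_mul hb0, mul_comm]; norm_num
  rw [hsq]
  rcases hp.eq_or_lt with hp0 | hp'
  · rw [← hp0]; norm_num; exact heα
  set ε : ℝ := α / (2 * p) with hε
  have hε0 : 0 < ε := by positivity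
  have hlog : Real.log e⁻¹ ≤ (e⁻¹) ^ ε / ε := Real.log_le_rpow_div (inv_nonneg.2 he.le) hε0
  have hinvε : 1 ≤ (e⁻¹) ^ ε := Real.one_le_rpow hinv1 hε0.le
  have hbase : 1 + Real.log e⁻¹ ≤ (1 + 1 / ε) * (e⁻¹) ^ ε := by
    calc 1 + Real.log e⁻¹ ≤ (e⁻¹) ^ ε + (e⁻¹) ^ ε / ε := add_le_add hinvε hlog
      _ = (1 + 1 / ε) * (e⁻¹) ^ ε := by ring
  have hc0 : 0 ≤ 1 + 1 / ε := by positivity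
  have hpow : (1 + Real.log e⁻¹) ^ (2 * p) ≤ ((1 + 1 / ε) * (e⁻¹) ^ ε) ^ (2 * p) :=
    Real.rpow_le_rpow hb0 hbase (by positivity)
  have hsplit : ((1 + 1 / ε) * (e⁻¹) ^ ε) ^ (2 * p) = (1 + 1 / ε) ^ (2 * p) * e ^ (-α) := by
    rw [Real.mul_rpow hc0 (Real.rpow_nonneg (inv_nonneg.2 he.le) ε), ← Real.rpow_mul (inv_nonneg.2 he.le),
      Real.inv_rpow he.le, ← Real.rpow_neg he.le]
    congr 2
    rw [hε]; field_simp
  have h1ε : 1 + 1 / ε = 1 + 2 * p / α := by rw [hε]; field_simp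
  calc e ^ α * (1 + Real.log e⁻¹) ^ (2 * p) ≤ e ^ α * ((1 + 1 / ε) ^ (2 * p) * e ^ (-α)) :=
        mul_le_mul_of_nonneg_left (hpow.trans_eq hsplit) heα0
    _ = (1 + 1 / ε) ^ (2 * p) * (e ^ α * e ^ (-α)) := by ring
    _ = (1 + 2 * p / α) ^ (2 * p) := by
        rw [← Real.rpow_add he, add_neg_cancel, Real.rpow_zero, mul_one, h1ε]

/-- kernel: `((1+2p)^p)² = (1+2p)^{2p}` (`p ≥ 0`). [cite: BalabanImbrieJaffe1985, (7.3.1) p.326] -/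
theorem calP_const_sq {p : ℝ} (hp : 0 ≤ p) : ((1 + 2 * p) ^ p) ^ 2 = (1 + 2 * p) ^ (2 * p) := by
  have h0 : (0 : ℝ) ≤ 1 + 2 * p := by linarith
  rw [← Real.rpow_natCast, ← Real.rpow_mul h0, mul_comm]; norm_num

/-- **The printed rate, case `α = 1`**: `0 ≤ τ ≤ K·e·(1 + ln e^{−1})^p` with `0 < e ≤ 1`, `0 ≤ p` gives
`τ² ≤ (K(1+2p)^p)²·e^{2−1}`, any real `K` (in print `τ = e_k‖𝒟_k∂^*Q^{e*}_kf^{(k)}‖_∞ ≤ Ke_k𝓅(e_k)` and the mass term is `Me_k^{2−α}`). [cite: BalabanImbrieJaffe1985, (7.3.2) p.326] -/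
theorem sq_le_of_calP_rate {τ K e p : ℝ} (hτ : 0 ≤ τ) (he : 0 < e) (he1 : e ≤ 1) (hp : 0 ≤ p)
    (hrate : τ ≤ K * e * (1 + Real.log e⁻¹) ^ p) : τ ^ 2 ≤ (K * (1 + 2 * p) ^ p) ^ 2 * e ^ (2 - 1 : ℝ) := by
  have hP0 : 0 ≤ (1 + Real.log e⁻¹) ^ p :=
    Real.rpow_nonneg (by linarith [Real.log_nonneg ((one_le_inv₀ he).2 he1)]) p
  have h1 : τ ^ 2 ≤ (K * e * (1 + Real.log e⁻¹) ^ p) ^ 2 := pow_le_pow_left₀ hτ hrate 2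
  have h2 := rpow_mul_calP_sq_le he he1 one_pos hp
  rw [Real.rpow_one, div_one] at h2
  have h21 : e ^ (2 - 1 : ℝ) = e := by norm_num
  rw [h21, mul_pow, calP_const_sq hp]
  calc τ ^ 2 ≤ (K * e * (1 + Real.log e⁻¹) ^ p) ^ 2 := h1
    _ = K ^ 2 * e * (e * ((1 + Real.log e⁻¹) ^ p) ^ 2) := by ring
    _ ≤ K ^ 2 * e * (1 + 2 * p) ^ (2 * p) := mul_le_mul_of_nonneg_left h2 (by positivity)
    _ = K ^ 2 * (1 + 2 * p) ^ (2 * p) * e := by ring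

/-! ## §2 r15's `Claim73` for the (4.5.4)-background family with the PRINTED-FORM rate -/

/-- Index of the (4.5.4)-BACKGROUND FAMILY with the rate IN THE PRINTED FORM: p11's `FlatIdx`, `0 < e_k ≤ 1`, ANY `v`, ANY bondwise phase `θ`
with a sup bound `T`, the block-scale smallness `36d(2d+1)²(L^kT)² ≤ 1`, and `L^kT ≤ K·e_k·(1 + ln e_k^{−1})^p` — the (7.2.2)-shaped bound
`‖𝒟_k∂^*Q^{e*}_kf^{(k)}‖_∞ ≤ K𝓅(e_k)` read on the phase `θ = −e_kη𝒟_k∂^*Q^{e*}_kf^{(k)}` at `η = L^{−k}`. [cite: BalabanImbrieJaffe1985, (7.3.1) p.326] -/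
structure BgIdxP (d : ℕ) (K p : ℝ) where
  base : FlatIdx d
  ek : ℝ
  hek : 0 < ek
  hek1 : ek ≤ 1
  v : GaugeField base.P (base.j + base.k) U1
  θ : PBond base.P base.j → ℝ
  T : ℝ
  hT : 0 ≤ T
  hθ : ∀ b, |θ b| ≤ T
  hsmall : 36 * d * (2 * d + 1) ^ 2 * ((base.P.L : ℝ) ^ base.k * T) ^ 2 ≤ 1
  hrate : (base.P.L : ℝ) ^ base.k * T ≤ K * ek * (1 + Real.log ek⁻¹) ^ p

/-- The printed-form index is an index of file 5's family at `K′ = K(1+2p)^p`, `α₀ = 1` (`sq_le_of_calP_rate`). [cite: BalabanImbrieJaffe1985, (7.3.2) p.326] -/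
def BgIdxP.toBgIdx {d : ℕ} {K p : ℝ} (hp : 0 ≤ p) (i : BgIdxP d K p) : BgIdx d (K * (1 + 2 * p) ^ p) 1 where
  base := i.base
  ek := i.ek
  v := i.v
  θ := i.θ
  T := i.T
  hT := i.hT
  hθ := i.hθ
  hsmall := i.hsmall
  hrate := sq_le_of_calP_rate (mul_nonneg (pow_nonneg (Nat.cast_nonneg _) _) i.hT) i.hek i.hek1 hp i.hrate

/-- **The (4.5.4)-background Sect. 7.3 data with the printed-form rate**: file 5's carrier instance at the converted index (`⟨ψ, Δ_k(Q^{s*}_kv·e^{iθ})ψ⟩`,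
printed `a_k`, physical normalization, honest `|v(∂p) − 1|`, `e_k` of the index). [cite: BalabanImbrieJaffe1985, (7.3.2) p.326] -/
def bgStabDataP {d : ℕ} {K p : ℝ} (a : ℝ) (ha : 0 < a) (hp : 0 ≤ p) (i : BgIdxP d K p) :
    BIJ85Sect7Statements.ScalarStabData :=
  bgStabData a ha (i.toBgIdx hp)

/-- kernel: the index `v = 1`, `θ = 0`, `T = 0`, `e_k = 1` is admissible (`0 ≤ K·1·(1 + ln 1)^p`) and satisfies (7.3.1) — the instance below
is not vacuous on the hypothesis side. [cite: BalabanImbrieJaffe1985, (7.3.1) p.326] -/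
theorem hyp731_backgroundP_one {d : ℕ} {K p : ℝ} (a : ℝ) (ha : 0 < a) (hK : 0 ≤ K) (hp : 0 ≤ p) (b : FlatIdx d) (pexp : ℝ) :
    (bgStabDataP a ha hp (⟨b, 1, one_pos, le_rfl, 1, fun _ => 0, 0, le_rfl, fun _ => by simp, by simp,
      by rw [mul_zero, inv_one, Real.log_one, add_zero, Real.one_rpow, mul_one, mul_one]; exact hK⟩ : BgIdxP d K p)).Hyp731 pexp := by
  intro q
  have e : plaqVar (cfg (1 : GaugeField b.P (b.j + b.k) U1)) q = 1 := by
    simp [plaqVar, cfg, show ∀ c, (1 : GaugeField b.P (b.j + b.k) U1) c = 1 from fun _ => rfl, toC_one]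
  show ‖plaqVar (cfg (1 : GaugeField b.P (b.j + b.k) U1)) q - 1‖ ≤ 1 * (1 + Real.log 1⁻¹) ^ pexp
  simp [e]

/-- **r15's typed claim of Sect. 7.3 `ScalarStabData.Claim73 𝓅 fam` PROVED FOR THE FAMILY OF (4.5.4)-SHAPED BACKGROUNDS WITH THE PRINTED-FORM
RATE** over `BgIdxP d K p` (every torus, every `k ≥ 1`, `0 < e_k ≤ 1`, EVERY `v`, every phase with `|θ_b| ≤ T`, `36d(2d+1)²(L^kT)² ≤ 1` and
`L^kT ≤ K·e_k·𝓅(e_k)`, `𝓅(e_k) = (1 + ln e_k^{−1})^p` the factor of (7.3.1)): **`γ = min(a/(10d), ⅕)`, `α = 1`, `M = 32γd(2d+1)²(K(1+2p)^p)²`**,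
for every real `K` and every `p ≥ 0`.  HONEST SCOPE: the rate field is the located form of (7.2.2) under (7.3.1) (row C1.Eq7.2.2); (7.3.1) itself is then
not needed. [cite: BalabanImbrieJaffe1985, (7.3.1)–(7.3.2) p.326] -/
theorem claim73_backgroundP {d : ℕ} (hd : 0 < d) (a : ℝ) (ha : 0 < a) (K : ℝ) {p : ℝ} (hp : 0 ≤ p) :
    BIJ85Sect7Statements.ScalarStabData.Claim73 p (bgStabDataP (d := d) (K := K) (p := p) a ha hp) :=
  ⟨min (a / (10 * d)) (1 / 5), 1, 32 * min (a / (10 * d)) (1 / 5) * (d * (2 * d + 1) ^ 2 * (K * (1 + 2 * p) ^ p) ^ 2),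
    lt_min (by positivity) (by norm_num), one_pos, fun i _ => ineq732_bgStabData a ha (i.toBgIdx hp)⟩

end

end Literature.MathematicalPhysics.QuantumFieldTheory.BalabanImbrieJaffe1984to88.BIJ85Ineq732BackgroundRate
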